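import Literature.Dynamics.NBody.AlbouyKaloshin2012ReflectionSymmetry
import Literature.Dynamics.NBody.AlbouyKaloshin2012SliceBranchesCC
import Literature.Dynamics.NBody.AlbouyKaloshin2012Scaling
import Mathlib.Tactic
import HarnessLib

/-!
# Reflection symmetry of type (3 4) for `(1,1,b,b,c)`: reduction to type (1 2) for `(1,1,1/b,1/b,c/b)`

Topic `Literature/Dynamics/NBody`; `pub-smale6` cell, seat 1 gen 3. For the masses `(1,1,b,b,c)` with
`b, c` generic the mass-preserving involutions of the bodies are `id`, (1 2), (3 4), (1 2)(3 4); the types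
(1 2) and (1 2)(3 4) are reduced to the `T12` / `T1234` slices in `AlbouyKaloshin2012ReflectionSymmetry.lean`.
This file treats type (3 4) — a reflection exchanging bodies 3, 4 and fixing 1, 2, 5 — by the elementary
symmetries of system (1) of [AlbouyKaloshin2012] (p. 535), proved here for all `n`:

* `newtonForce_perm` — relabelling the bodies by a permutation `σ`;
* `newtonForce_rot90` — rotating every position by 90°;
* `newtonForce_smul_masses`, `newtonForce_smul_pos` — `f(s·m, q) = s·f(m, q)` and `f(m, s·q) = s⁻²·f(m, q)` (`s > 0`).

Consequently `transfer34 s q := k ↦ s · rot90 (q (σ k))` with `σ = (1 3)(2 4)` and `s³ = 1/b` maps a type-(3 4)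
symmetric positive normalized CC of `(1,1,b,b,c)` to a type-(1 2) symmetric positive normalized CC of
`(1,1,1/b,1/b,c/b)` (the horizontal mirror becomes vertical, the normalization `y₁ = y₂` of Definition 1 is
restored by the rotation, the multiplier by the scaling), injectively; so `reflSymm34CCs b c` is finite as soon
as the two `T12` branch systems at `(1/b, c/b)` are (`reflSymm34CCs_finite_of_two`). For the Roberts masses
`(1,1,1,1,1/4)` these are the SAME branch systems `T12(1,1/4) ++++`, `+++-` as for type (1 2)
(`roberts_reflSymm34CCs_finite_of_two`).
-/

namespace Literature.Dynamics.NBody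

open Finset

/-- `f_k` of system (1) as a sum over all bodies (the diagonal term vanishes). [folklore] -/
theorem newtonForce_eq_sum_univ {n : ℕ} (m : Fin n → ℝ) (q : Fin n → ℝ × ℝ) (k : Fin n) :
    newtonForce m q k = ∑ l, (m l / Real.sqrt (sqDist (q k) (q l)) ^ 3) • (q k - q l) := by
  unfold newtonForce
  exact Finset.sum_erase _ (by simp)

/-- Relabelling symmetry of system (1): `f(m ∘ σ, q ∘ σ)_k = f(m, q)_{σ k}`. [folklore] -/
theorem newtonForce_perm {n : ℕ} (m : Fin n → ℝ) (q : Fin n → ℝ × ℝ) (σ : Equiv.Perm (Fin n))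
    (k : Fin n) : newtonForce (m ∘ σ) (q ∘ σ) k = newtonForce m q (σ k) := by
  rw [newtonForce_eq_sum_univ, newtonForce_eq_sum_univ]
  simp only [Function.comp_apply]
  exact Equiv.sum_comp σ (fun l => (m l / Real.sqrt (sqDist (q (σ k)) (q l)) ^ 3) • (q (σ k) - q l))

/-- Rotation of the plane by 90°, as a linear map. [folklore] -/
def rot90 : (ℝ × ℝ) →ₗ[ℝ] (ℝ × ℝ) := (-(LinearMap.snd ℝ ℝ ℝ)).prod (LinearMap.fst ℝ ℝ ℝ)

/-- `rot90 (x, y) = (−y, x)`. [folklore] -/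
@[simp] theorem rot90_apply (p : ℝ × ℝ) : rot90 p = (-p.2, p.1) := rfl

/-- `rot90` is injective. [folklore] -/
theorem rot90_injective : Function.Injective rot90 := by
  intro p p' h
  simp only [rot90_apply, Prod.mk.injEq, neg_inj] at h
  exact Prod.ext h.2 h.1

/-- `rot90` preserves squared distances. [folklore] -/
theorem sqDist_rot90 (p q : ℝ × ℝ) : sqDist (rot90 p) (rot90 q) = sqDist p q := by
  simp [sqDist]; ring

/-- Rotation symmetry of system (1): `f(m, rot90 ∘ q)_k = rot90 (f(m, q)_k)`. [folklore] -/
theorem newtonForce_rot90 {n : ℕ} (m : Fin n → ℝ) (q : Fin n → ℝ × ℝ) (k : Fin n) :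
    newtonForce m (fun l => rot90 (q l)) k = rot90 (newtonForce m q k) := by
  rw [newtonForce_eq_sum_univ, newtonForce_eq_sum_univ, map_sum]
  refine Finset.sum_congr rfl fun l _ => ?_
  rw [sqDist_rot90, map_smul, map_sub]

/-- Mass scaling of system (1): `f(s·m, q) = s·f(m, q)`. [folklore] -/
theorem newtonForce_smul_masses {n : ℕ} (s : ℝ) (m : Fin n → ℝ) (q : Fin n → ℝ × ℝ) (k : Fin n) :
    newtonForce (s • m) q k = s • newtonForce m q k := by
  rw [newtonForce_eq_sum_univ, newtonForce_eq_sum_univ, Finset.smul_sum]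
  refine Finset.sum_congr rfl fun l _ => ?_
  rw [Pi.smul_apply, smul_eq_mul, smul_smul, mul_div_assoc]

/-- `sqDist` is non-negative. [folklore] -/
theorem sqDist_nonneg (p q : ℝ × ℝ) : 0 ≤ sqDist p q := by
  unfold sqDist; positivity

/-- Position scaling of system (1): `f(m, s·q) = s⁻²·f(m, q)` for `s > 0`. [folklore] -/
theorem newtonForce_smul_pos {n : ℕ} {s : ℝ} (hs : 0 < s) (m : Fin n → ℝ) (q : Fin n → ℝ × ℝ)
    (k : Fin n) : newtonForce m (s • q) k = (s ^ 2)⁻¹ • newtonForce m q k := by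
  rw [newtonForce_eq_sum_univ, newtonForce_eq_sum_univ, Finset.smul_sum]
  refine Finset.sum_congr rfl fun l _ => ?_
  rw [Pi.smul_apply, Pi.smul_apply, sqDist_smul, Real.sqrt_mul (sq_nonneg s), Real.sqrt_sq hs.le,
    ← smul_sub, smul_smul, smul_smul, mul_pow]
  congr 1
  have hs0 : s ≠ 0 := hs.ne'
  field_simp

/-- Positive normalized CCs of `(1,1,b,b,c)` with a reflection symmetry of permutation type (3 4): some line
reflection fixes bodies 1, 2, 5 and exchanges bodies 3, 4. [folklore] -/
def reflSymm34CCs (b c : ℝ) : Set (Fin 5 → ℝ × ℝ) :=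
  {q | IsPositiveNormalizedCC (e32Masses b c) q ∧ ∃ a β d : ℝ, a ^ 2 + β ^ 2 = 1 ∧
    reflLine a β d (q 0) = q 0 ∧ reflLine a β d (q 1) = q 1 ∧ reflLine a β d (q 2) = q 3 ∧
    reflLine a β d (q 4) = q 4}

/-- The relabelling `(1 3)(2 4)` of the five bodies (0-indexed: `0 ↔ 2`, `1 ↔ 3`). [folklore] -/
def swap1324 : Equiv.Perm (Fin 5) := Equiv.swap 0 2 * Equiv.swap 1 3

/-- Value of the relabelling `(1 3)(2 4)` at body `0`. [folklore] -/
@[simp] theorem swap1324_0 : swap1324 0 = 2 := by decide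
/-- Value of the relabelling `(1 3)(2 4)` at body `1`. [folklore] -/
@[simp] theorem swap1324_1 : swap1324 1 = 3 := by decide
/-- Value of the relabelling `(1 3)(2 4)` at body `2`. [folklore] -/
@[simp] theorem swap1324_2 : swap1324 2 = 0 := by decide
/-- Value of the relabelling `(1 3)(2 4)` at body `3`. [folklore] -/
@[simp] theorem swap1324_3 : swap1324 3 = 1 := by decide
/-- Value of the relabelling `(1 3)(2 4)` at body `4`. [folklore] -/
@[simp] theorem swap1324_4 : swap1324 4 = 4 := by decide

/-- The transfer map: relabel by `(1 3)(2 4)`, rotate by 90°, scale by `s`. [folklore] -/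
noncomputable def transfer34 (s : ℝ) (q : Fin 5 → ℝ × ℝ) : Fin 5 → ℝ × ℝ :=
  fun k => s • rot90 (q (swap1324 k))

/-- `transfer34 s` is injective on configurations for `s ≠ 0`. [folklore] -/
theorem transfer34_injective {s : ℝ} (hs : s ≠ 0) : Function.Injective (transfer34 s) := by
  intro q q' h
  have hk : ∀ k, q (swap1324 k) = q' (swap1324 k) := fun k =>
    rot90_injective (smul_right_injective _ hs (congrFun h k))
  funext k
  simpa using hk (swap1324.symm k)

/-- The masses seen by the transferred configuration: `(1,1,b,b,c) ∘ (1 3)(2 4) = b · (1,1,1/b,1/b,c/b)`.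
[folklore] -/
theorem e32Masses_comp_swap1324 {b : ℝ} (hb : b ≠ 0) (c : ℝ) :
    b⁻¹ • (e32Masses b c ∘ swap1324) = e32Masses b⁻¹ (c * b⁻¹) := by
  funext k
  fin_cases k <;> simp [e32Masses, inv_mul_cancel₀ hb, mul_comm]

/-- A horizontal reflection conjugated by `p ↦ s · rot90 p` is a vertical reflection. [folklore] -/
theorem smul_rot90_reflLine {β s d : ℝ} (hβ : β ^ 2 = 1) (p : ℝ × ℝ) :
    s • rot90 (reflLine 0 β d p) = reflLine 1 0 (-(s * β * d)) (s • rot90 p) := by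
  refine Prod.ext ?_ ?_
  · simp [reflLine]; linear_combination ((2 : ℝ) * s * p.2) * hβ
  · simp [reflLine]

/-- The transfer of a type-(3 4) symmetric positive normalized CC of `(1,1,b,b,c)` (`b > 0`, `s³ = 1/b`) is
a positive normalized CC of `(1,1,1/b,1/b,c/b)` with a type-(1 2) reflection symmetry. [folklore] -/
theorem transfer34_spec {b c s : ℝ} (hb : 0 < b) (hs : 0 < s) (hs3 : s ^ 3 = b⁻¹)
    {q : Fin 5 → ℝ × ℝ} (hq : q ∈ reflSymm34CCs b c) :
    IsPositiveNormalizedCC (e32Masses b⁻¹ (c * b⁻¹)) (transfer34 s q) ∧ ∃ d' : ℝ,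
      reflLine 1 0 d' (transfer34 s q 0) = transfer34 s q 1 ∧
      reflLine 1 0 d' (transfer34 s q 2) = transfer34 s q 2 ∧
      reflLine 1 0 d' (transfer34 s q 3) = transfer34 s q 3 ∧
      reflLine 1 0 d' (transfer34 s q 4) = transfer34 s q 4 := by
  obtain ⟨hcc, a, β, d, hab, h0, h1, h23, h4⟩ := hq
  have hy : (q 1).2 = (q 0).2 := by
    have := hcc.2.2 (by norm_num) (by norm_num); simpa using this
  have hne : q 0 ≠ q 1 := hcc.1 0 1 (by decide)
  -- the mirror is horizontal: a = 0
  have hx0 := congrArg Prod.fst h0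
  have hy0 := congrArg Prod.snd h0
  have hx1 := congrArg Prod.fst h1
  have hy1 := congrArg Prod.snd h1
  simp only [reflLine] at hx0 hy0 hx1 hy1
  have ht0 : a * (q 0).1 + β * (q 0).2 - d = 0 := by
    linear_combination (-(1:ℝ)/2 * a) * hx0 + (-(1:ℝ)/2 * β) * hy0 -
      (a * (q 0).1 + β * (q 0).2 - d) * hab
  have ht1 : a * (q 1).1 + β * (q 1).2 - d = 0 := by
    linear_combination (-(1:ℝ)/2 * a) * hx1 + (-(1:ℝ)/2 * β) * hy1 -
      (a * (q 1).1 + β * (q 1).2 - d) * hab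
  have ha : a = 0 := by
    have hprod : a * ((q 0).1 - (q 1).1) = 0 := by linear_combination ht0 - ht1 + β * hy
    rcases mul_eq_zero.mp hprod with h | h
    · exact h
    · exfalso; apply hne
      exact Prod.ext (by linarith) hy.symm
  subst ha
  have hβ : β ^ 2 = 1 := by simpa using hab
  -- the original reflection is `reflLine 0 β d`; its conjugate is vertical
  set d' : ℝ := -(s * β * d) with hd'
  have key : ∀ p : ℝ × ℝ, s • rot90 (reflLine 0 β d p) = reflLine 1 0 d' (s • rot90 p) :=
    fun p => smul_rot90_reflLine hβ p
  refine ⟨⟨?_, ?_, ?_⟩, d', ?_, ?_, ?_, ?_⟩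
  · -- pairwise distinct
    intro k l hkl heq
    have hσ : swap1324 k ≠ swap1324 l := fun h => hkl (swap1324.injective h)
    exact hcc.1 _ _ hσ (rot90_injective (smul_right_injective _ hs.ne' heq))
  · -- system (1) for the new masses
    intro k
    have hfun : transfer34 s q = s • fun l => rot90 ((q ∘ swap1324) l) := by
      funext l; simp [transfer34]
    rw [← e32Masses_comp_swap1324 hb.ne' c, hfun, newtonForce_smul_pos hs, newtonForce_smul_masses,
      newtonForce_rot90, newtonForce_perm, ← hcc.2.1 (swap1324 k)]
    simp only [Pi.smul_apply, Function.comp_apply, smul_smul]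
    congr 1
    have hs0 : s ≠ 0 := hs.ne'
    rw [← hs3, show s ^ 3 = s ^ 2 * s by ring, ← mul_assoc, inv_mul_cancel₀ (pow_ne_zero 2 hs0), one_mul]
  · -- normalization y₁ = y₂ for the new bodies 1, 2 (old bodies 3, 4 have equal abscissae)
    intro h0' h1'
    have hx23 : (q 2).1 = (q 3).1 := by
      have := congrArg Prod.fst h23; simpa [reflLine] using this
    show (transfer34 s q 1).2 = (transfer34 s q 0).2
    simp [transfer34, hx23]
  · show reflLine 1 0 d' (s • rot90 (q (swap1324 0))) = s • rot90 (q (swap1324 1))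
    rw [swap1324_0, swap1324_1, ← h23, key]
  · show reflLine 1 0 d' (s • rot90 (q (swap1324 2))) = s • rot90 (q (swap1324 2))
    rw [swap1324_2]; conv_rhs => rw [← h0]; rw [key]
  · show reflLine 1 0 d' (s • rot90 (q (swap1324 3))) = s • rot90 (q (swap1324 3))
    rw [swap1324_3]; conv_rhs => rw [← h1]; rw [key]
  · show reflLine 1 0 d' (s • rot90 (q (swap1324 4))) = s • rot90 (q (swap1324 4))
    rw [swap1324_4]; conv_rhs => rw [← h4]; rw [key]

/-- The transfer lands in the `T12` slice of `(1,1,1/b,1/b,c/b)`. [folklore] -/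
theorem transfer34_mem_t12PositiveCCs {b c s : ℝ} (hb : 0 < b) (hM : 2 + 2 * b + c ≠ 0) (hs : 0 < s)
    (hs3 : s ^ 3 = b⁻¹) {q : Fin 5 → ℝ × ℝ} (hq : q ∈ reflSymm34CCs b c) :
    transfer34 s q ∈ t12PositiveCCs b⁻¹ (c * b⁻¹) := by
  obtain ⟨hcc', d', h01, h2, h3, h4⟩ := transfer34_spec hb hs hs3 hq
  have hM' : 2 + 2 * b⁻¹ + c * b⁻¹ ≠ 0 := by
    have hb0 : b ≠ 0 := hb.ne'
    intro h
    apply hM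
    have : (2 + 2 * b⁻¹ + c * b⁻¹) * b = 2 * b + 2 + c := by field_simp
    linear_combination (-1 : ℝ) * this + b * h
  exact ⟨hcc', exists_t12Q_of_reflection hM' hcc' (a := 1) (β := 0) (d := d') (by norm_num) h01 h2 h3 h4⟩

/-- Finiteness of the type-(3 4) symmetric positive normalized CCs of `(1,1,b,b,c)` (`b > 0`, `2 + 2b + c ≠ 0`)
from finiteness of the two `T12` branch systems `++++`, `+++-` at the point `(1/b, c/b)`. [folklore] -/
theorem reflSymm34CCs_finite_of_two {b c : ℝ} (hb : 0 < b) (hM : 2 + 2 * b + c ≠ 0)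
    (hA : (t12BranchSet 1 1 1 1 b⁻¹ (c * b⁻¹)).Finite)
    (hB : (t12BranchSet 1 1 1 (-1) b⁻¹ (c * b⁻¹)).Finite) : (reflSymm34CCs b c).Finite := by
  set s : ℝ := (b⁻¹) ^ ((1 : ℝ) / 3) with hs_def
  have hbi : 0 < b⁻¹ := inv_pos.mpr hb
  have hs : 0 < s := Real.rpow_pos_of_pos hbi _
  have hs3 : s ^ 3 = b⁻¹ := by
    rw [hs_def, ← Real.rpow_natCast, ← Real.rpow_mul hbi.le]
    norm_num
  have hfin := t12PositiveCCs_finite_of_two b⁻¹ (c * b⁻¹) hA hB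
  refine (hfin.preimage (transfer34_injective hs.ne').injOn).subset ?_
  intro q hq
  exact transfer34_mem_t12PositiveCCs hb hM hs hs3 hq

/-- Roberts masses `(1,1,1,1,1/4)`: the type-(3 4) reflection-symmetric positive normalized CCs are finite in
number once the branch systems `T12(1,1/4) ++++` and `+++-` are — the same two systems as for type (1 2).
[folklore] -/
theorem roberts_reflSymm34CCs_finite_of_two
    (hA : (t12BranchSet 1 1 1 1 1 (1 / 4)).Finite) (hB : (t12BranchSet 1 1 1 (-1) 1 (1 / 4)).Finite) :
    (reflSymm34CCs 1 (1 / 4)).Finite := by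
  refine reflSymm34CCs_finite_of_two one_pos (by norm_num) ?_ ?_
  · simpa using hA
  · simpa using hB

end Literature.Dynamics.NBody
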